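import Mathlib
import HarnessLib
import Summits.Ventures.LatticeQCDFlow.Exactness.SphereLatticeLaplacianSpectrum

/-!
# Lüscher's operator on the lattice polynomials of degree `≤ N`, restricted to the spheres, is self-adjoint in `L²(π)`: an orthonormal eigenbasis with eigenvalues among the labels, and the Bernstein inequality `Σ_k ∫‖∂̃_k f‖² ≤ N(N+d−2) ∫ f²`

HONEST FRAMING: exact (Metropolis-corrected) sampling algorithms for lattice gauge theory;
figures of merit are autocorrelation/cost numbers at stated couplings and volumes; no
continuum-physics claim.

Venture `LatticeQCDFlow` (cell pub-lqcd), topic `Exactness`; FANOUT row 7 (`s0-cpn-null`: the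
S0-D1 rung — 2D CP⁹, Lüscher's LO trivializing map inside HMC, Engel–Schaefer 2011).  NEW WORK of
the cell over the tree's `Exactness/SphereLatticeLaplacianSpectrum.lean` (every `Ω`-eigenvalue of
`−Σ_k ∂̃_k·∂̃_k` on `polyS N` is a label `Σ_n c_n(c_n + d − 2)`),
`Exactness/LatticeSitePolynomialOperator.lean` (`polyLap N`), `Exactness/SphereLatticeGreen.lean`
(symmetry `∫ G·𝔏₀F = ∫ F·𝔏₀G` and `∫ F·𝔏₀F = Σ_k ∫‖∂̃_k F‖²`) and
`Exactness/SphereLatticePoissonSolver.lean` (`rhoP`: restriction to `Ω`); Mathlib's spectral theorem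
for symmetric operators (`LinearMap.IsSymmetric.eigenvectorBasis`); nothing is cited as a fact.
Printed counterpart, NAMED ONLY: M. Lüscher, Commun. Math. Phys. 293 (2010) 899, §3.3 (the
Laplacian is symmetric and non-negative on the finite-dimensional invariant spaces, "and can thus be
diagonalized"); Engel–Schaefer, Comput. Phys. Commun. 182 (2011) 2107, §3.

## Content (`E` finite-dimensional, `d = dim E`; `Λ` finite; `Ω = S(E)^Λ`, `π = ⊗_Λ σ`,
## `σ = volume.toSphere`)

* `VΩ Λ E N` — the space `polyS N|_Ω` of restrictions of lattice polynomials of degree `≤ N` to the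
  product of unit spheres, AS A TYPE (so that it carries the `L²(π)` norm and no other topology);
  `toV` (restriction, surjective), `l2Core` and the instances: **`VΩ N` IS A FINITE-DIMENSIONAL REAL
  INNER PRODUCT SPACE with `⟪u, v⟫ = ∫ u v dπ`** (definiteness: members are continuous, `π` charges
  open sets).
* **`LΩ Λ E N : VΩ N →ₗ[ℝ] VΩ N`** — `𝔏₀ = −Σ_k ∂̃_k·∂̃_k` ON `VΩ N` (well defined: `𝔏₀` on `Ω` only
  sees the restriction), `LΩ_toV` (`LΩ (f|_Ω) = (𝔏 f)|_Ω`); **`isSymmetric_LΩ`**, **`inner_LΩ_self`**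
  (`⟪v, 𝔏₀v⟫ = Σ_k ∫ ‖∂̃_k f‖² ≥ 0`).
* **`exists_eigLabel_of_hasEigenvalue_LΩ`**: every eigenvalue of `LΩ N` is a label;
  **`exists_orthonormal_eigenbasis_LΩ`** — THE SPECTRAL THEOREM FOR LÜSCHER'S OPERATOR ON LATTICE
  POLYNOMIALS: an `L²(π)`-orthonormal basis of `polyS N|_Ω` of eigenfunctions of `−Σ_k ∂̃_k·∂̃_k`,
  every eigenvalue of the form `Σ_n c_n (c_n + d − 2)` for a site monomial of degree `≤ N` (so in
  `{0} ∪ [d − 1, N(N + d − 2)]`, independently of `Λ`).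
* **`inner_LΩ_le`**, **`bernstein_polyS`** — THE INVERSE (BERNSTEIN) INEQUALITY:
  `Σ_k ∫ ‖∂̃_k f‖² dπ ≤ N (N + d − 2) · ∫ f² dπ` for every lattice polynomial `f` of degree `≤ N`,
  WITH A CONSTANT INDEPENDENT OF THE VOLUME (the reverse of the gap inequality
  `(d−1)·Var_π f ≤ Σ_k ∫‖∂̃_k f‖²` of `Exactness/SphereLatticePoincare`).

NOT CLAIMED: that every label is attained; multiplicities; anything about flows at `t > 0` or the
rung's numbers.
-/

noncomputable section

namespace Summit.Ventures.LatticeQCDFlow.Exactness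

open Function Set Metric MeasureTheory Polynomial
open scoped RealInnerProductSpace

variable {Λ : Type*} {E : Type*} [NormedAddCommGroup E] [InnerProductSpace ℝ E]
  [FiniteDimensional ℝ E]

/-! ## §1 The restriction space `polyS N|_Ω` as an `L²(π)` inner product space -/

section Space

variable (Λ E) in
/-- **`VΩ Λ E N`**: the restrictions to the product of unit spheres of the lattice polynomials of
degree `≤ N` — the carrier of `LinearMap.range (rhoP (polyS Λ E N))`, as a type of its own (it is
given the `L²(π)` norm below and inherits no other topology). -/
def VΩ (N : ℕ) : Type _ := ↥(LinearMap.range (rhoP (polyS Λ E N)))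

/-- The additive group structure of `VΩ N` (that of the range submodule). -/
instance (N : ℕ) : AddCommGroup (VΩ Λ E N) :=
  inferInstanceAs (AddCommGroup ↥(LinearMap.range (rhoP (polyS Λ E N))))

/-- The real vector space structure of `VΩ N` (that of the range submodule). -/
instance (N : ℕ) : Module ℝ (VΩ Λ E N) :=
  inferInstanceAs (Module ℝ ↥(LinearMap.range (rhoP (polyS Λ E N))))

/-- `VΩ N` is finite-dimensional (a quotient of `polyS N`). -/
instance [Fintype Λ] (N : ℕ) : FiniteDimensional ℝ (VΩ Λ E N) :=
  inferInstanceAs (FiniteDimensional ℝ ↥(LinearMap.range (rhoP (polyS Λ E N))))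

/-- The underlying function on `Ω` of a member of `VΩ N`. -/
def VΩ.val {N : ℕ} (v : VΩ Λ E N) : (Λ → sphere (0 : E) 1) → ℝ := Subtype.val v

/-- Members of `VΩ N` are functions on `Ω`. -/
instance (N : ℕ) : CoeFun (VΩ Λ E N) (fun _ => (Λ → sphere (0 : E) 1) → ℝ) := ⟨VΩ.val⟩

/-- The membership certificate of a member of `VΩ N`. -/
theorem VΩ.mem {N : ℕ} (v : VΩ Λ E N) :
    (v : (Λ → sphere (0 : E) 1) → ℝ) ∈ LinearMap.range (rhoP (polyS Λ E N)) :=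
  Subtype.property v

/-- Extensionality in `VΩ N`. -/
theorem VΩ.ext {N : ℕ} {u v : VΩ Λ E N}
    (h : (u : (Λ → sphere (0 : E) 1) → ℝ) = (v : (Λ → sphere (0 : E) 1) → ℝ)) : u = v :=
  Subtype.ext h

/-- Pointwise addition in `VΩ N`. -/
@[simp] theorem VΩ.add_apply {N : ℕ} (u v : VΩ Λ E N) (ω : Λ → sphere (0 : E) 1) :
    (u + v) ω = u ω + v ω := rfl

/-- Pointwise scalar multiplication in `VΩ N`. -/
@[simp] theorem VΩ.smul_apply {N : ℕ} (c : ℝ) (u : VΩ Λ E N) (ω : Λ → sphere (0 : E) 1) :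
    (c • u) ω = c * u ω := rfl

/-- The zero of `VΩ N` is the zero function. -/
@[simp] theorem VΩ.zero_apply {N : ℕ} (ω : Λ → sphere (0 : E) 1) : (0 : VΩ Λ E N) ω = 0 := rfl

variable (Λ E) in
/-- **Restriction to the spheres** `polyS N → VΩ N`, `f ↦ f|_Ω` (surjective by construction). -/
def toV (N : ℕ) : polyS Λ E N →ₗ[ℝ] VΩ Λ E N := LinearMap.rangeRestrict (rhoP (polyS Λ E N))

/-- Unfolding `toV`. -/
@[simp] theorem toV_apply {N : ℕ} (f : polyS Λ E N) (ω : Λ → sphere (0 : E) 1) :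
    (toV Λ E N f) ω = (f : (Λ → E) → ℝ) (fun n => (ω n : E)) := rfl

/-- `toV` is surjective. -/
theorem toV_surjective (N : ℕ) : Surjective (toV Λ E N) :=
  LinearMap.surjective_rangeRestrict _

/-- Members of `VΩ N` are continuous functions on `Ω`. -/
theorem VΩ.continuous [Fintype Λ] {N : ℕ} (v : VΩ Λ E N) :
    Continuous (v : (Λ → sphere (0 : E) 1) → ℝ) :=
  continuous_of_mem_range_rhoP (polyS_contDiff_two N) v.mem

end Space

section L2

variable [MeasurableSpace E] [BorelSpace E] [Fintype Λ]

/-- Products of members of `VΩ N` are `π`-integrable. -/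
theorem VΩ.integrable_mul {N : ℕ} (u v : VΩ Λ E N) :
    Integrable (fun ω => u ω * v ω) (Measure.pi fun _ : Λ => (volume : Measure E).toSphere) :=
  integrable_pi_toSphere_of_continuous (u.continuous.mul v.continuous)

variable (Λ E) in
/-- **The `L²(π)` inner product core on `VΩ N`**: `⟪u, v⟫ = ∫ u v dπ`; definite because members are
continuous and `π` charges every open set. -/
abbrev l2Core (N : ℕ) : InnerProductSpace.Core ℝ (VΩ Λ E N) where
  inner u v := ∫ ω, u ω * v ω ∂Measure.pi fun _ : Λ => (volume : Measure E).toSphere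
  conj_inner_symm u v := by
    simp only [conj_trivial]
    exact integral_congr_ae (ae_of_all _ fun ω => mul_comm _ _)
  re_inner_nonneg u := by
    simp only [RCLike.re_to_real]
    exact integral_nonneg fun ω => mul_self_nonneg _
  add_left u v w := by
    show ∫ ω, (u + v) ω * w ω ∂_ = (∫ ω, u ω * w ω ∂_) + ∫ ω, v ω * w ω ∂_
    rw [← integral_add (u.integrable_mul w) (v.integrable_mul w)]
    refine integral_congr_ae (ae_of_all _ fun ω => ?_)
    simp only [VΩ.add_apply, add_mul]
  smul_left u v r := by
    show ∫ ω, (r • u) ω * v ω ∂_ = (starRingEnd ℝ) r * ∫ ω, u ω * v ω ∂_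
    rw [conj_trivial, ← integral_const_mul]
    refine integral_congr_ae (ae_of_all _ fun ω => ?_)
    simp only [VΩ.smul_apply, mul_assoc]
  definite u hu := by
    have hcont : Continuous fun ω => u ω * u ω := u.continuous.mul u.continuous
    have hae := (integral_eq_zero_iff_of_nonneg (fun ω => mul_self_nonneg _)
      (u.integrable_mul u)).1 hu
    haveI := Measure.pi.isOpenPosMeasure (fun _ : Λ => (volume : Measure E).toSphere)
    have hzero := (Continuous.ae_eq_iff_eq (Measure.pi fun _ : Λ => (volume : Measure E).toSphere)
      hcont (continuous_const : Continuous fun _ : Λ → sphere (0 : E) 1 => (0 : ℝ))).1 hae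
    apply VΩ.ext
    funext ω
    exact mul_self_eq_zero.1 (congrFun hzero ω)

/-- **The `L²(π)` norm on `VΩ N`** (`‖v‖² = ∫ v² dπ`). -/
instance (N : ℕ) : NormedAddCommGroup (VΩ Λ E N) :=
  @InnerProductSpace.Core.toNormedAddCommGroup ℝ _ _ _ _ (l2Core Λ E N)

/-- **`VΩ N` is a real inner product space for `⟪u, v⟫ = ∫ u v dπ`.** -/
instance (N : ℕ) : InnerProductSpace ℝ (VΩ Λ E N) := InnerProductSpace.ofCore _

/-- **Unfolding the inner product**: `⟪u, v⟫ = ∫ u v dπ`. -/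
theorem VΩ.inner_def {N : ℕ} (u v : VΩ Λ E N) :
    ⟪u, v⟫ = ∫ ω, u ω * v ω ∂Measure.pi fun _ : Λ => (volume : Measure E).toSphere := rfl

end L2

/-! ## §2 `𝔏₀` on `VΩ N`: well defined, symmetric, non-negative -/

section Operator

variable [Fintype Λ] [DecidableEq Λ]

/-- **`𝔏₀` on `Ω` only sees the restriction**: `ker toV ≤ ker (toV ∘ 𝔏)`. -/
theorem ker_toV_le (N : ℕ) :
    LinearMap.ker (toV Λ E N) ≤ LinearMap.ker (toV Λ E N ∘ₗ polyLap Λ E N) := by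
  intro f hf
  rw [LinearMap.mem_ker] at hf ⊢
  apply VΩ.ext
  funext ω
  have h0 : ∀ ξ : Λ → sphere (0 : E) 1, (f : (Λ → E) → ℝ) (fun n => (ξ n : E)) =
      ((0 : polyS Λ E N) : (Λ → E) → ℝ) (fun n => (ξ n : E)) := fun ξ => by
    rw [Submodule.coe_zero, Pi.zero_apply]
    exact congrFun (congrArg (fun v : VΩ Λ E N => (v : (Λ → sphere (0 : E) 1) → ℝ)) hf) ξ
  rw [LinearMap.comp_apply, toV_apply, polyLap_sphere_congr h0 ω, map_zero]
  rfl

variable (Λ E) in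
/-- **LÜSCHER'S OPERATOR ON `polyS N|_Ω`**: the endomorphism of `VΩ N` induced by `polyLap N`
(`f|_Ω ↦ (𝔏 f)|_Ω`, i.e. `−Σ_k ∂̃_k·∂̃_k` on the restrictions). -/
def LΩ (N : ℕ) : VΩ Λ E N →ₗ[ℝ] VΩ Λ E N :=
  (LinearMap.ker (toV Λ E N)).liftQ (toV Λ E N ∘ₗ polyLap Λ E N) (ker_toV_le N) ∘ₗ
    ((toV Λ E N).quotKerEquivOfSurjective (toV_surjective N)).symm.toLinearMap

/-- **`LΩ (f|_Ω) = (𝔏 f)|_Ω`.** -/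
@[simp] theorem LΩ_toV {N : ℕ} (f : polyS Λ E N) :
    LΩ Λ E N (toV Λ E N f) = toV Λ E N (polyLap Λ E N f) := by
  unfold LΩ
  rw [LinearMap.comp_apply, LinearEquiv.coe_toLinearMap,
    LinearMap.quotKerEquivOfSurjective_symm_apply, Submodule.liftQ_apply, LinearMap.comp_apply]

/-- `LΩ` evaluated: `(LΩ (f|_Ω))(ω) = −Σ_k ∂̃_k·∂̃_k f (ω)`. -/
theorem LΩ_toV_apply {N : ℕ} (f : polyS Λ E N) (ω : Λ → sphere (0 : E) 1) :
    (LΩ Λ E N (toV Λ E N f)) ω = -∑ k, siteLaplacian k (f : (Λ → E) → ℝ) (fun n => (ω n : E)) := by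
  rw [LΩ_toV, toV_apply, polyLap_apply_sphere]

variable [MeasurableSpace E] [BorelSpace E]

/-- **`𝔏₀` is symmetric in `L²(π)`** (`SphereLatticeGreen.integral_mul_sum_siteLaplacian_comm`). -/
theorem isSymmetric_LΩ [Nontrivial E] (N : ℕ) : (LΩ Λ E N).IsSymmetric := by
  intro u v
  obtain ⟨f, rfl⟩ := toV_surjective N u
  obtain ⟨g, rfl⟩ := toV_surjective N v
  rw [VΩ.inner_def, VΩ.inner_def]
  simp_rw [LΩ_toV_apply, toV_apply]
  have h := integral_mul_sum_siteLaplacian_comm (Λ := Λ) (polyS_contDiff_two N _ f.2)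
    (polyS_contDiff_two N _ g.2)
  have e1 : ∫ ω, (-∑ k, siteLaplacian k (f : (Λ → E) → ℝ) (fun n => ((ω : Λ → sphere (0 : E) 1) n : E))) *
      (g : (Λ → E) → ℝ) (fun n => (ω n : E)) ∂Measure.pi (fun _ : Λ => (volume : Measure E).toSphere) =
      -∫ ω, (g : (Λ → E) → ℝ) (fun n => ((ω : Λ → sphere (0 : E) 1) n : E)) *
        ∑ k, siteLaplacian k (f : (Λ → E) → ℝ) (fun n => (ω n : E))
        ∂Measure.pi (fun _ : Λ => (volume : Measure E).toSphere) := by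
    rw [← integral_neg]
    exact integral_congr_ae (ae_of_all _ fun ω => by ring)
  have e2 : ∫ ω, (f : (Λ → E) → ℝ) (fun n => ((ω : Λ → sphere (0 : E) 1) n : E)) *
      -∑ k, siteLaplacian k (g : (Λ → E) → ℝ) (fun n => (ω n : E))
        ∂Measure.pi (fun _ : Λ => (volume : Measure E).toSphere) =
      -∫ ω, (f : (Λ → E) → ℝ) (fun n => ((ω : Λ → sphere (0 : E) 1) n : E)) *
        ∑ k, siteLaplacian k (g : (Λ → E) → ℝ) (fun n => (ω n : E))
        ∂Measure.pi (fun _ : Λ => (volume : Measure E).toSphere) := by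
    rw [← integral_neg]
    exact integral_congr_ae (ae_of_all _ fun ω => by ring)
  rw [e1, e2, h]

/-- **`⟪f|_Ω, 𝔏₀ f|_Ω⟫ = Σ_k ∫ ‖∂̃_k f‖² dπ`** (the Dirichlet form). -/
theorem inner_LΩ_self [Nontrivial E] {N : ℕ} (f : polyS Λ E N) :
    ⟪toV Λ E N f, LΩ Λ E N (toV Λ E N f)⟫ =
      ∑ k, ∫ ω, ‖siteGrad k (f : (Λ → E) → ℝ) (fun n => ((ω : Λ → sphere (0 : E) 1) n : E))‖ ^ 2
        ∂Measure.pi (fun _ : Λ => (volume : Measure E).toSphere) := by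
  rw [VΩ.inner_def]
  simp_rw [LΩ_toV_apply, toV_apply]
  exact integral_mul_neg_sum_siteLaplacian_self (polyS_contDiff_two N _ f.2)

/-- **`𝔏₀ ≥ 0` on `VΩ N`.** -/
theorem inner_LΩ_self_nonneg [Nontrivial E] {N : ℕ} (v : VΩ Λ E N) : 0 ≤ ⟪v, LΩ Λ E N v⟫ := by
  obtain ⟨f, rfl⟩ := toV_surjective N v
  rw [inner_LΩ_self]
  exact Finset.sum_nonneg fun k _ => integral_nonneg fun ω => sq_nonneg _

omit [DecidableEq Λ] in
/-- **The norm**: `‖f|_Ω‖² = ∫ f² dπ`. -/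
theorem norm_toV_sq {N : ℕ} (f : polyS Λ E N) :
    ‖toV Λ E N f‖ ^ 2 = ∫ ω, (f : (Λ → E) → ℝ) (fun n => ((ω : Λ → sphere (0 : E) 1) n : E)) ^ 2
      ∂Measure.pi (fun _ : Λ => (volume : Measure E).toSphere) := by
  rw [← real_inner_self_eq_norm_sq, VΩ.inner_def]
  exact integral_congr_ae (ae_of_all _ fun ω => by simp only [toV_apply, sq])

end Operator

/-! ## §3 The spectral theorem for `𝔏₀` on the lattice polynomials -/

section Spectral

variable [MeasurableSpace E] [BorelSpace E] [Fintype Λ] [DecidableEq Λ]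

omit [MeasurableSpace E] [BorelSpace E] in
/-- **Every eigenvalue of `LΩ N` is a label** `Σ_n c_n (c_n + d − 2)` of a site monomial of degree
`≤ N` (`SphereLatticeLaplacianSpectrum.exists_eigLabel_of_sphere_eigenfunction`). -/
theorem exists_eigLabel_of_hasEigenvalue_LΩ {N : ℕ} {μ : ℝ}
    (h : Module.End.HasEigenvalue (LΩ Λ E N) μ) :
    ∃ k ≤ N, ∃ κs : Fin k → SiteCoord Λ E, μ = eigLabel κs := by
  obtain ⟨v, hv⟩ := h.exists_hasEigenvector
  obtain ⟨f, rfl⟩ := toV_surjective N v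
  have hμ : ∀ ξ : Λ → sphere (0 : E) 1,
      -∑ k, siteLaplacian k (f : (Λ → E) → ℝ) (fun n => (ξ n : E)) =
        μ * (f : (Λ → E) → ℝ) (fun n => (ξ n : E)) := fun ξ => by
    have h1 := congrFun (congrArg (fun w : VΩ Λ E N => (w : (Λ → sphere (0 : E) 1) → ℝ))
      (Module.End.mem_eigenspace_iff.1 hv.1)) ξ
    simp only [LΩ_toV_apply, VΩ.smul_apply, toV_apply] at h1
    exact h1
  have hne : ∃ ξ : Λ → sphere (0 : E) 1, (f : (Λ → E) → ℝ) (fun n => (ξ n : E)) ≠ 0 := by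
    by_contra hall
    push Not at hall
    exact hv.2 (VΩ.ext (funext fun ξ => by rw [toV_apply, hall ξ]; rfl))
  exact exists_eigLabel_of_sphere_eigenfunction N f.2 hμ hne

/-- **THE SPECTRAL THEOREM FOR LÜSCHER'S OPERATOR ON THE LATTICE POLYNOMIALS.**  `polyS N|_Ω`
has an `L²(π)`-orthonormal basis of eigenfunctions of `−Σ_k ∂̃_k·∂̃_k`, and every eigenvalue is
`Σ_n c_n (c_n + d − 2)` for the site counts `(c_n)` of a site monomial of degree `≤ N` — a finite
list depending on `N` and `d = dim E` only, not on `Λ`. -/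
theorem exists_orthonormal_eigenbasis_LΩ [Nontrivial E] (N : ℕ) :
    ∃ (b : OrthonormalBasis (Fin (Module.finrank ℝ (VΩ Λ E N))) ℝ (VΩ Λ E N))
      (μ : Fin (Module.finrank ℝ (VΩ Λ E N)) → ℝ),
      (∀ i, LΩ Λ E N (b i) = μ i • b i) ∧
      (∀ i, ∃ k ≤ N, ∃ κs : Fin k → SiteCoord Λ E, μ i = eigLabel κs) := by
  have hT := isSymmetric_LΩ (Λ := Λ) (E := E) N
  refine ⟨hT.eigenvectorBasis rfl, hT.eigenvalues rfl, fun i => ?_, fun i => ?_⟩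
  · simp
  · exact exists_eigLabel_of_hasEigenvalue_LΩ (hT.hasEigenvalue_eigenvalues rfl i)

/-- **Rayleigh bound from an eigenbasis**: if a symmetric `T` has an orthonormal eigenbasis with
eigenvalues `≤ M` then `⟪v, T v⟫ ≤ M ‖v‖²`. -/
theorem inner_le_of_eigenbasis {V : Type*} [NormedAddCommGroup V] [InnerProductSpace ℝ V]
    {ι : Type*} [Fintype ι] (b : OrthonormalBasis ι ℝ V) {T : V →ₗ[ℝ] V} (hT : T.IsSymmetric)
    {μ : ι → ℝ} (hb : ∀ i, T (b i) = μ i • b i) {M : ℝ} (hM : ∀ i, μ i ≤ M) (v : V) :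
    ⟪v, T v⟫ ≤ M * ‖v‖ ^ 2 := by
  have h1 : ⟪v, T v⟫ = ∑ i, μ i * ⟪v, b i⟫ ^ 2 := by
    rw [← b.sum_inner_mul_inner v (T v)]
    refine Finset.sum_congr rfl fun i _ => ?_
    rw [← hT (b i) v, hb i, real_inner_smul_left, real_inner_comm (b i) v]
    ring
  have h2 : ‖v‖ ^ 2 = ∑ i, ⟪v, b i⟫ ^ 2 := by
    rw [← real_inner_self_eq_norm_sq, ← b.sum_inner_mul_inner v v]
    exact Finset.sum_congr rfl fun i _ => by rw [real_inner_comm (b i) v, sq]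
  rw [h1, h2, Finset.mul_sum]
  exact Finset.sum_le_sum fun i _ => mul_le_mul_of_nonneg_right (hM i) (sq_nonneg _)

/-- **`⟪v, 𝔏₀ v⟫ ≤ N (N + d − 2) ‖v‖²` on `polyS N|_Ω`.** -/
theorem inner_LΩ_le [Nontrivial E] (N : ℕ) (v : VΩ Λ E N) :
    ⟪v, LΩ Λ E N v⟫ ≤ (N : ℝ) * (N + (Module.finrank ℝ E : ℝ) - 2) * ‖v‖ ^ 2 := by
  obtain ⟨b, μ, hb, hμ⟩ := exists_orthonormal_eigenbasis_LΩ (Λ := Λ) (E := E) N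
  refine inner_le_of_eigenbasis b (isSymmetric_LΩ N) hb (fun i => ?_) v
  obtain ⟨k, hk, κs, h⟩ := hμ i
  rw [h]
  exact eigLabel_le_of_le Module.finrank_pos hk κs

/-- **THE BERNSTEIN (INVERSE) INEQUALITY FOR LATTICE POLYNOMIALS ON `S(E)^Λ`.**  For every lattice
polynomial `f` of degree `≤ N` in the real site coordinates,
`Σ_k ∫ ‖∂̃_k f‖² dπ ≤ N (N + d − 2) · ∫ f² dπ` — the constant depends on the degree and on
`d = dim E` only, NOT ON THE NUMBER OF SITES. -/
theorem bernstein_polyS [Nontrivial E] (N : ℕ) {f : (Λ → E) → ℝ} (hf : f ∈ polyS Λ E N) :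
    ∑ k, ∫ ω, ‖siteGrad k f (fun n => ((ω : Λ → sphere (0 : E) 1) n : E))‖ ^ 2
        ∂Measure.pi (fun _ : Λ => (volume : Measure E).toSphere) ≤
      (N : ℝ) * (N + (Module.finrank ℝ E : ℝ) - 2) *
        ∫ ω, f (fun n => ((ω : Λ → sphere (0 : E) 1) n : E)) ^ 2
          ∂Measure.pi (fun _ : Λ => (volume : Measure E).toSphere) := by
  have h := inner_LΩ_le (Λ := Λ) (E := E) N (toV Λ E N ⟨f, hf⟩)
  rwa [inner_LΩ_self, norm_toV_sq] at h

end Spectral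

end Summit.Ventures.LatticeQCDFlow.Exactness

end
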